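import Summits.QuantumFields.BalabanUV.T4Continuum.Support.ShellMeasureLocalGradientTail

/-!
# `T4Continuum.ShellMeasureGradientTailHD` — WALL §2 (a) item (P4): THE HD-TERMS OF [Balaban1985Variational] (80) AS ONE
# COMPOSITION, at the level of the POTENTIAL: a functional vanishing to THIRD order on a ball has a gradient of the (98)
# SHAPE `B11Prop6Scheme.Prop4Hyp` (Cauchy), and the four terms of (80) — `−⟨HD₃(A′),J⟩ − ⟨A′,Δ_πHD(A′)⟩ + ½⟨HD(A′),Δ_πHD(A′)⟩
# + V₀(A′ − HD(A′))` — vanish to third order with an EXPLICIT constant polynomial in the binders' constants (cell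
# `pub-balaban`, sub-cell `t4`, spine estimate NE7c (node U5b); NE7c ROUND-2 crew `t4-ne7c-formalise-*`, unit
# `b2b-balaban-t4-ne7c-formalise-leaf-06` gen 3, owner table `LEAVES-NE7c-P1.md` row S66; ADDITIVE — imports the owner's
# S62 `ShellMeasureLocalGradientTail` (p220699; hence `B11Prop6Scheme`, `B8SectDSource`) ONLY; [folklore]; 0 def, 0 sorry)

HONEST FRAMING.  Finite four-torus programme, rung (B)+1 only — NOT infinite volume, NOT a mass gap, NOT the Clay
problem, NOT summit progress.  NE7c is NOT PRINTED and NOT PROVED; «NE7c ⇐ the named binders».  ABSTRACT complex-Banach-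
space bookkeeping ([folklore]); nothing printed is asserted: B11 (80) and (85)–(89) pp. 290–291 are LOCATORS for the
SHAPE.  Every analytic input is a DISPLAYED binder in `B11Prop6Scheme`'s currency — `H : 𝒳 →L[ℂ] 𝒴` with `‖H‖ ≤ B₀`
(WALL (46) = [5] Thm 3.12, the deep wall), the Landau correction `D : 𝒴 → 𝒳` with (55) `‖D(A′)‖ ≤ c_D‖A′‖²` (the `Cf`
item, rows S55∕S56∕S64; print: `c_D = 4C₂`) and its order-≥3 part `D₃` with `‖D₃(A′)‖ ≤ c₃‖A′‖³` (p. 289's remark on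
`𝔇₂`, TYPE), the source functional `J` with `‖J‖ ≤ j₀` ((28)-type: `j₀ = C₁B₃ε₁`), the pairing `⟨·, Δ_π ·⟩` as a bounded
bilinear form `P` with `‖P‖ ≤ p₀` ([5] (3.132), binder), and the plaquette part `V₀` = «terms of order ≥ 3» with
`|V₀(A)| ≤ K₀‖A‖³` on a ball (the POTENTIAL-level form of the owner's S62∕S65 plaquette item; S62's `prop4Hyp_locGrad`
is its bond-localised GRADIENT-level one-grid face — the junction «potential cubic ⇒ bond-local gradient tail» is NOT
made here).  HONEST DEPENDENCY (cell): continuum YM on T⁴ ⇐ BetaPertH ∧ nine spine estimates (0/9 proved); BetaPertH ⇐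
(D1) ∧ (D4) ∧ CAP+tail; G-an2-4 gates asym, D1 and NE2/3/4.

* §1 **`prop4Hyp_fderiv_of_cubic`** — `V : 𝒴 → F` (`F` complete) ANALYTIC on `ball 0 R` with
  `‖V y‖ ≤ K‖y‖³` there ⟹ `Prop4Hyp (fderiv ℂ V) (8K) (R∕2)` (Cauchy: `B8SectDSource.norm_fderiv_le_of_norm_le` on the
  ball of radius `2‖y‖`; at `y = 0` the derivative vanishes by the same bound along `t ↓ 0`).
* §2 **`cubic_of_HD_binders`** — the four terms of (80) under the binders above satisfy, on `ball 0 r` with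
  `r ≤ 1`, `r ≤ R`, `c_D·B₀·r ≤ 1` (so `‖A′ − HD(A′)‖ ≤ 2‖A′‖ < R₀` once `2r ≤ R₀`), the cubic bound with
  `K = j₀B₀c₃ + p₀B₀c_D + p₀B₀²c_D²∕2 + 8K₀`; **`prop4Hyp_of_HD_binders`** = §1 ∘ §2: the gradient of (80)'s `V` has
  `Prop4Hyp (fderiv ℂ V) (8K) (r∕2)` — (85)–(89)'s TYPE as ONE theorem.
NOT HERE: the weighted multi-scale norms `|·|_{(−1)}`, `|∇·|_{(−2)}`, `|·|_{(−3)}` (row S65), the commutator terms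
(91)–(96), the identification with Bałaban's sectioned `V` ([dict]); NE7c NOT proved; 0/9 spine.
-/

noncomputable section

open Metric Set Filter
open scoped Topology

namespace Summit.QuantumFields.BalabanUV.T4Continuum.ShellMeasureGradientTailHD

open Literature.MathematicalPhysics.QuantumFieldTheory.Balaban1983to89
open B11Prop6Scheme (Prop4Hyp)
open B8SectDSource (norm_fderiv_le_of_norm_le)

variable {𝒴 : Type*} [NormedAddCommGroup 𝒴] [NormedSpace ℂ 𝒴] {F : Type*} [NormedAddCommGroup F] [NormedSpace ℂ F]
  [CompleteSpace F]

/-! ## §1 Third-order vanishing of a potential ⟹ the (98) SHAPE for its gradient -/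

omit [CompleteSpace F] in
/-- **CAUCHY: CUBIC POTENTIAL ⟹ QUADRATIC GRADIENT.**  `V` complex-differentiable on `ball 0 R` with `‖V y‖ ≤ K‖y‖³`
there ⟹ for `‖y‖ < R∕2`: `‖fderiv ℂ V y‖ ≤ 8K‖y‖²` (the Cauchy estimate `norm_fderiv_le_of_norm_le` on the ball of
radius `2‖y‖`, where `‖V‖ ≤ 8K‖y‖³`; at `y = 0` along `t ↓ 0`). [folklore] -/
theorem norm_fderiv_le_of_cubic {V : 𝒴 → F} {R K : ℝ} (hR : 0 < R) (hK : 0 ≤ K)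
    (hV : DifferentiableOn ℂ V (ball 0 R)) (hb : ∀ y ∈ ball (0 : 𝒴) R, ‖V y‖ ≤ K * ‖y‖ ^ 3)
    {y : 𝒴} (hy : ‖y‖ < R / 2) : ‖fderiv ℂ V y‖ ≤ 8 * K * ‖y‖ ^ 2 := by
  -- the Cauchy estimate on `ball 0 (‖y‖ + t)` for every admissible `t`
  have key : ∀ t : ℝ, 0 < t → ‖y‖ + t ≤ R → ‖fderiv ℂ V y‖ ≤ K * (‖y‖ + t) ^ 3 / t := by
    intro t ht htR
    have hsub : ball (0 : 𝒴) (‖y‖ + t) ⊆ ball 0 R := ball_subset_ball htR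
    have h := norm_fderiv_le_of_norm_le (hV.mono hsub) (M := K * (‖y‖ + t) ^ 3)
      (fun z hz => (hb z (hsub hz)).trans (by
        have hz' : ‖z‖ ≤ ‖y‖ + t := (mem_ball_zero_iff.1 hz).le
        exact mul_le_mul_of_nonneg_left (pow_le_pow_left₀ (norm_nonneg z) hz' 3) hK))
      (x := y) (by linarith)
    rwa [show ‖y‖ + t - ‖y‖ = t by ring] at h
  by_cases hy0 : y = 0
  · -- at the origin: `‖DV 0‖ ≤ K t²` for all small `t > 0`
    subst hy0
    rw [norm_zero, zero_pow two_ne_zero, mul_zero]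
    have hev : ∀ᶠ t in 𝓝[>] (0 : ℝ), ‖fderiv ℂ V (0 : 𝒴)‖ ≤ K * t ^ 2 := by
      have hI : Ioo (0 : ℝ) R ∈ 𝓝[>] (0 : ℝ) := Ioo_mem_nhdsGT hR
      filter_upwards [hI] with t ht
      have h := key t ht.1 (by rw [norm_zero, zero_add]; exact ht.2.le)
      rw [norm_zero, zero_add] at h
      calc ‖fderiv ℂ V (0 : 𝒴)‖ ≤ K * t ^ 3 / t := h
        _ = K * t ^ 2 := by field_simp
    have hlim : Tendsto (fun t : ℝ => K * t ^ 2) (𝓝[>] (0 : ℝ)) (𝓝 0) := by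
      have hc : Continuous (fun t : ℝ => K * t ^ 2) := continuous_const.mul (continuous_id.pow 2)
      exact (hc.tendsto' (0 : ℝ) 0 (by simp)).mono_left nhdsWithin_le_nhds
    exact ge_of_tendsto hlim hev
  · have hpos : 0 < ‖y‖ := norm_pos_iff.2 hy0
    have h := key ‖y‖ hpos (by linarith)
    calc ‖fderiv ℂ V y‖ ≤ K * (‖y‖ + ‖y‖) ^ 3 / ‖y‖ := h
      _ = 8 * K * ‖y‖ ^ 2 := by field_simp; ring

/-- **THE (98) SHAPE FOR THE GRADIENT OF A POTENTIAL VANISHING TO THIRD ORDER**: `Prop4Hyp (fderiv ℂ V) (8K) (R∕2)`.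
[folklore] -/
theorem prop4Hyp_fderiv_of_cubic {V : 𝒴 → F} {R K : ℝ} (hR : 0 < R) (hK : 0 ≤ K)
    (hV : AnalyticOnNhd ℂ V (ball 0 R)) (hb : ∀ y ∈ ball (0 : 𝒴) R, ‖V y‖ ≤ K * ‖y‖ ^ 3) :
    Prop4Hyp (fderiv ℂ V) (8 * K) (R / 2) where
  quad Y hY := norm_fderiv_le_of_cubic hR hK hV.differentiableOn hb hY
  differentiableOn := by
    have han : DifferentiableOn ℂ (fderiv ℂ V) (ball 0 R) := hV.fderiv.differentiableOn
    refine han.mono fun Y hY => ?_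
    rw [mem_setOf_eq] at hY
    exact mem_ball_zero_iff.2 (by linarith)

/-! ## §2 The four HD-terms of (80) vanish to third order -/

section HD

variable {𝒳 : Type*} [NormedAddCommGroup 𝒳] [NormedSpace ℂ 𝒳]

/-- **THE HD-TERMS OF (80) ARE OF THIRD ORDER, WITH AN EXPLICIT CONSTANT.**  Binders: `H : 𝒳 →L[ℂ] 𝒴` (`‖H‖ ≤ B₀`),
`D D₃ : 𝒴 → 𝒳` with `‖D A′‖ ≤ c_D‖A′‖²`, `‖D₃ A′‖ ≤ c₃‖A′‖³` on `ball 0 R`, `J : 𝒳 →L[ℂ] ℂ`-type source read through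
`H` as the functional `Jf : 𝒴 →L[ℂ] ℂ` (`‖Jf‖ ≤ j₀`), the pairing `P : 𝒴 →L[ℂ] 𝒴 →L[ℂ] ℂ` (`‖P‖ ≤ p₀`), the plaquette part
`V₀ : 𝒴 → ℂ` with `‖V₀ A‖ ≤ K₀‖A‖³` on `ball 0 R₀`; radius `r` with `r ≤ R`, `2r ≤ R₀`, `r ≤ 1`, `B₀·c_D·r ≤ 1`.  Then
`V A′ := −Jf (H (D₃ A′)) − P A′ (H (D A′)) + ½ P (H (D A′)) (H (D A′)) + V₀ (A′ − H (D A′))` satisfies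
`‖V A′‖ ≤ (j₀B₀c₃ + p₀B₀c_D + p₀B₀²c_D²∕2 + 8K₀)·‖A′‖³` on `ball 0 r`. [folklore] -/
theorem cubic_of_HD_binders (H : 𝒳 →L[ℂ] 𝒴) {B₀ : ℝ} (hB₀ : 0 ≤ B₀) (hH : ‖H‖ ≤ B₀)
    (D D₃ : 𝒴 → 𝒳) {R c_D c₃ : ℝ} (hcD : 0 ≤ c_D)
    (hD : ∀ A' ∈ ball (0 : 𝒴) R, ‖D A'‖ ≤ c_D * ‖A'‖ ^ 2) (hD₃ : ∀ A' ∈ ball (0 : 𝒴) R, ‖D₃ A'‖ ≤ c₃ * ‖A'‖ ^ 3)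
    (Jf : 𝒴 →L[ℂ] ℂ) {j₀ : ℝ} (hJ : ‖Jf‖ ≤ j₀) (P : 𝒴 →L[ℂ] 𝒴 →L[ℂ] ℂ) {p₀ : ℝ} (hP : ‖P‖ ≤ p₀)
    (V₀ : 𝒴 → ℂ) {R₀ K₀ : ℝ} (hK₀ : 0 ≤ K₀) (hV₀ : ∀ A ∈ ball (0 : 𝒴) R₀, ‖V₀ A‖ ≤ K₀ * ‖A‖ ^ 3)
    {r : ℝ} (hrR : r ≤ R) (hrR₀ : 2 * r ≤ R₀) (hr1 : r ≤ 1) (hsmall : B₀ * c_D * r ≤ 1)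
    {A' : 𝒴} (hA : A' ∈ ball (0 : 𝒴) r) :
    ‖-Jf (H (D₃ A')) - P A' (H (D A')) + (1 / 2 : ℂ) * P (H (D A')) (H (D A')) + V₀ (A' - H (D A'))‖
      ≤ (j₀ * B₀ * c₃ + p₀ * B₀ * c_D + p₀ * B₀ ^ 2 * c_D ^ 2 / 2 + 8 * K₀) * ‖A'‖ ^ 3 := by
  have ha : ‖A'‖ < r := mem_ball_zero_iff.1 hA
  have ha0 : 0 ≤ ‖A'‖ := norm_nonneg _
  have hAR : A' ∈ ball (0 : 𝒴) R := mem_ball_zero_iff.2 (ha.trans_le hrR)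
  have hj₀ : 0 ≤ j₀ := (norm_nonneg Jf).trans hJ
  have hp₀ : 0 ≤ p₀ := (norm_nonneg P).trans hP
  have hDA := hD A' hAR
  have hD₃A := hD₃ A' hAR
  have hHD : ‖H (D A')‖ ≤ B₀ * (c_D * ‖A'‖ ^ 2) :=
    (H.le_opNorm _).trans (mul_le_mul hH hDA (norm_nonneg _) hB₀)
  have hHD₃ : ‖H (D₃ A')‖ ≤ B₀ * (c₃ * ‖A'‖ ^ 3) :=
    (H.le_opNorm _).trans (mul_le_mul hH hD₃A (norm_nonneg _) hB₀)
  -- `‖H(D A′)‖ ≤ ‖A′‖` on the ball (`B₀ c_D r ≤ 1`), so `‖A′ − HD(A′)‖ ≤ 2‖A′‖ < R₀`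
  have hHD1 : ‖H (D A')‖ ≤ ‖A'‖ := by
    refine hHD.trans ?_
    have h1 : B₀ * c_D * ‖A'‖ ≤ 1 := by nlinarith [mul_nonneg hB₀ hcD]
    nlinarith [mul_nonneg (mul_nonneg hB₀ hcD) ha0]
  have hsub : ‖A' - H (D A')‖ ≤ 2 * ‖A'‖ := (norm_sub_le _ _).trans (by linarith)
  have hsubR : A' - H (D A') ∈ ball (0 : 𝒴) R₀ := mem_ball_zero_iff.2 (by linarith)
  -- the four terms
  have t1 : ‖-Jf (H (D₃ A'))‖ ≤ j₀ * B₀ * c₃ * ‖A'‖ ^ 3 := by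
    rw [norm_neg]
    refine (Jf.le_opNorm _).trans ?_
    calc ‖Jf‖ * ‖H (D₃ A')‖ ≤ j₀ * (B₀ * (c₃ * ‖A'‖ ^ 3)) := mul_le_mul hJ hHD₃ (norm_nonneg _) hj₀
      _ = j₀ * B₀ * c₃ * ‖A'‖ ^ 3 := by ring
  have t2 : ‖P A' (H (D A'))‖ ≤ p₀ * B₀ * c_D * ‖A'‖ ^ 3 := by
    refine (P.le_opNorm₂ _ _).trans ?_
    calc ‖P‖ * ‖A'‖ * ‖H (D A')‖ ≤ p₀ * ‖A'‖ * (B₀ * (c_D * ‖A'‖ ^ 2)) :=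
          mul_le_mul (mul_le_mul_of_nonneg_right hP ha0) hHD (norm_nonneg _) (mul_nonneg hp₀ ha0)
      _ = p₀ * B₀ * c_D * ‖A'‖ ^ 3 := by ring
  have t3 : ‖(1 / 2 : ℂ) * P (H (D A')) (H (D A'))‖ ≤ p₀ * B₀ ^ 2 * c_D ^ 2 / 2 * ‖A'‖ ^ 3 := by
    rw [norm_mul]
    have hhalf : ‖(1 / 2 : ℂ)‖ = 1 / 2 := by simp
    rw [hhalf]
    have hq : ‖P (H (D A')) (H (D A'))‖ ≤ p₀ * (B₀ * (c_D * ‖A'‖ ^ 2)) ^ 2 := by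
      refine (P.le_opNorm₂ _ _).trans ?_
      have h0 : 0 ≤ ‖H (D A')‖ := norm_nonneg _
      calc ‖P‖ * ‖H (D A')‖ * ‖H (D A')‖ ≤ p₀ * (B₀ * (c_D * ‖A'‖ ^ 2)) * (B₀ * (c_D * ‖A'‖ ^ 2)) :=
            mul_le_mul (mul_le_mul hP hHD h0 hp₀) hHD h0 (mul_nonneg hp₀ (h0.trans hHD))
        _ = p₀ * (B₀ * (c_D * ‖A'‖ ^ 2)) ^ 2 := by ring
    have h4 : ‖A'‖ ^ 4 ≤ ‖A'‖ ^ 3 := by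
      calc ‖A'‖ ^ 4 = ‖A'‖ ^ 3 * ‖A'‖ := by ring
        _ ≤ ‖A'‖ ^ 3 * 1 := mul_le_mul_of_nonneg_left (ha.le.trans hr1) (by positivity)
        _ = ‖A'‖ ^ 3 := mul_one _
    calc 1 / 2 * ‖P (H (D A')) (H (D A'))‖ ≤ 1 / 2 * (p₀ * (B₀ * (c_D * ‖A'‖ ^ 2)) ^ 2) :=
          mul_le_mul_of_nonneg_left hq (by norm_num)
      _ = p₀ * B₀ ^ 2 * c_D ^ 2 / 2 * ‖A'‖ ^ 4 := by ring
      _ ≤ p₀ * B₀ ^ 2 * c_D ^ 2 / 2 * ‖A'‖ ^ 3 := mul_le_mul_of_nonneg_left h4 (by positivity)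
  have t4 : ‖V₀ (A' - H (D A'))‖ ≤ 8 * K₀ * ‖A'‖ ^ 3 := by
    refine (hV₀ _ hsubR).trans ?_
    calc K₀ * ‖A' - H (D A')‖ ^ 3 ≤ K₀ * (2 * ‖A'‖) ^ 3 :=
          mul_le_mul_of_nonneg_left (pow_le_pow_left₀ (norm_nonneg _) hsub 3) hK₀
      _ = 8 * K₀ * ‖A'‖ ^ 3 := by ring
  have e1 := norm_add_le (-Jf (H (D₃ A')) - P A' (H (D A')) + (1 / 2 : ℂ) * P (H (D A')) (H (D A')))
    (V₀ (A' - H (D A')))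
  have e2 := norm_add_le (-Jf (H (D₃ A')) - P A' (H (D A'))) ((1 / 2 : ℂ) * P (H (D A')) (H (D A')))
  have e3 := norm_sub_le (-Jf (H (D₃ A'))) (P A' (H (D A')))
  nlinarith [e1, e2, e3, t1, t2, t3, t4]

/-- **(85)–(89) AS ONE THEOREM — THE GRADIENT OF (80)'s `V` HAS THE (98) SHAPE.**  Under the binders of
`cubic_of_HD_binders` plus analyticity of `D`, `D₃` on `ball 0 R` and of `V₀` on `ball 0 R₀`:
`Prop4Hyp (fderiv ℂ V) (8K) (r∕2)` with `K = j₀B₀c₃ + p₀B₀c_D + p₀B₀²c_D²∕2 + 8K₀` — END-II's `hW` SHAPE at one grid for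
the HD-substituted action; the displayed inputs are exactly (46) `H`, (55) `D`, the order-3 part `D₃`, the source bound,
the pairing bound and the plaquette part's cubic bound. [folklore] -/
theorem prop4Hyp_of_HD_binders (H : 𝒳 →L[ℂ] 𝒴) {B₀ : ℝ} (hB₀ : 0 ≤ B₀) (hH : ‖H‖ ≤ B₀)
    (D D₃ : 𝒴 → 𝒳) {R c_D c₃ : ℝ} (hcD : 0 ≤ c_D) (hc₃ : 0 ≤ c₃)
    (hDd : AnalyticOnNhd ℂ D (ball 0 R)) (hD₃d : AnalyticOnNhd ℂ D₃ (ball 0 R))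
    (hD : ∀ A' ∈ ball (0 : 𝒴) R, ‖D A'‖ ≤ c_D * ‖A'‖ ^ 2) (hD₃ : ∀ A' ∈ ball (0 : 𝒴) R, ‖D₃ A'‖ ≤ c₃ * ‖A'‖ ^ 3)
    (Jf : 𝒴 →L[ℂ] ℂ) {j₀ : ℝ} (hJ : ‖Jf‖ ≤ j₀) (P : 𝒴 →L[ℂ] 𝒴 →L[ℂ] ℂ) {p₀ : ℝ} (hP : ‖P‖ ≤ p₀)
    (V₀ : 𝒴 → ℂ) {R₀ K₀ : ℝ} (hK₀ : 0 ≤ K₀) (hV₀d : AnalyticOnNhd ℂ V₀ (ball 0 R₀))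
    (hV₀ : ∀ A ∈ ball (0 : 𝒴) R₀, ‖V₀ A‖ ≤ K₀ * ‖A‖ ^ 3)
    {r : ℝ} (hr : 0 < r) (hrR : r ≤ R) (hrR₀ : 2 * r ≤ R₀) (hr1 : r ≤ 1) (hsmall : B₀ * c_D * r ≤ 1) :
    Prop4Hyp (fderiv ℂ (fun A' : 𝒴 =>
        -Jf (H (D₃ A')) - P A' (H (D A')) + (1 / 2 : ℂ) * P (H (D A')) (H (D A')) + V₀ (A' - H (D A'))))
      (8 * (j₀ * B₀ * c₃ + p₀ * B₀ * c_D + p₀ * B₀ ^ 2 * c_D ^ 2 / 2 + 8 * K₀)) (r / 2) := by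
  have hj₀ : 0 ≤ j₀ := (norm_nonneg Jf).trans hJ
  have hp₀ : 0 ≤ p₀ := (norm_nonneg P).trans hP
  refine prop4Hyp_fderiv_of_cubic hr (by positivity) ?_ fun A' hA =>
    cubic_of_HD_binders H hB₀ hH D D₃ hcD hD hD₃ Jf hJ P hP V₀ hK₀ hV₀ hrR hrR₀ hr1 hsmall hA
  -- analyticity of the composite at every point of `ball 0 r`
  intro A' hA
  have hsub : ball (0 : 𝒴) r ⊆ ball 0 R := ball_subset_ball hrR
  have hDa : AnalyticAt ℂ D A' := hDd A' (hsub hA)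
  have hD₃a : AnalyticAt ℂ D₃ A' := hD₃d A' (hsub hA)
  have hHD : AnalyticAt ℂ (fun A' => H (D A')) A' := (H.analyticAt _).comp hDa
  have hHD₃ : AnalyticAt ℂ (fun A' => H (D₃ A')) A' := (H.analyticAt _).comp hD₃a
  have hmem : A' - H (D A') ∈ ball (0 : 𝒴) R₀ := by
    have ha : ‖A'‖ < r := mem_ball_zero_iff.1 hA
    have hHD1 : ‖H (D A')‖ ≤ ‖A'‖ := by
      have h := (H.le_opNorm _).trans (mul_le_mul hH (hD A' (hsub hA)) (norm_nonneg _) hB₀)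
      refine h.trans ?_
      nlinarith [mul_nonneg (mul_nonneg hB₀ hcD) (norm_nonneg A'), norm_nonneg A']
    exact mem_ball_zero_iff.2 (by linarith [norm_sub_le A' (H (D A'))])
  have hV₀c : AnalyticAt ℂ (fun A' => V₀ (A' - H (D A'))) A' :=
    (hV₀d _ hmem).comp_of_eq (analyticAt_id.sub hHD) rfl
  have h1 : AnalyticAt ℂ (fun A' => -Jf (H (D₃ A'))) A' := ((Jf.analyticAt _).comp hHD₃).neg
  have hPb := P.analyticAt_bilinear
  have h2 : AnalyticAt ℂ (fun A' => P A' (H (D A'))) A' :=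
    (hPb (A', H (D A'))).comp_of_eq (analyticAt_id.prod hHD) rfl
  have h3' : AnalyticAt ℂ (fun A' => P (H (D A')) (H (D A'))) A' :=
    (hPb (H (D A'), H (D A'))).comp_of_eq (hHD.prod hHD) rfl
  have h3 : AnalyticAt ℂ (fun A' => (1 / 2 : ℂ) * P (H (D A')) (H (D A'))) A' := analyticAt_const.mul h3'
  exact ((h1.sub h2).add h3).add hV₀c

end HD

end Summit.QuantumFields.BalabanUV.T4Continuum.ShellMeasureGradientTailHD

end
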